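import Summits.BirchSwinnertonDyer.BirchSwinnertonDyer.Theorems.GenusKolyvaginAtTwoGenusPrimitiveSupplyAtTwoPosDiscShallowKFourPosHalvingDescentCorollaries
import Summits.BirchSwinnertonDyer.BirchSwinnertonDyer.Theorems.GenusKolyvaginAtTwoShaCardDvdPowAtTwoRTShaFiniteAtTwoRankQ
import Summits.BirchSwinnertonDyer.BirchSwinnertonDyer.Theorems.GenusKolyvaginAtTwoShaCardDvdPowAtTwoPosTDefectOneBitLaw
import HarnessLib

/-!
# Route `GenusKolyvaginAtTwo`, cruxes K₄⁺ `K4Pos` (stmt-BirchSwinnertonDyer-31469) / K₄ `K4Neg` (stmt-BirchSwinnertonDyer-31526):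
# THE K₄ WITNESS FROM THE BSD CARDINALITY OVER `ℚ` — `#Ш(E/ℚ)[2^∞] = 4^(M₀)` on the cut ⟹ the conclusion of K4Pos / K4Neg (mod Q2)

Seat `bsd-line-gk2-p4` g29 (cell `bsd-f1-sign2`), WIDTH-5 attach on route `GenusKolyvaginAtTwo` rev 59.  THEOREMS ONLY (no definition, no named
fact, no `sorry`); standard axioms.  **BSD is NOT proved by this file; K4Pos / K4Neg are NOT proved; no item is closed.**  CONDITIONAL on the
route item Q2 `KolyvaginRelationAtTwo` (24880; a tree theorem modulo the print fact 23091), displayed as `hQ2`, exactly like gk2-p5 g36's B2Q♭.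

WHAT (LEAD-BRIEF-g23-ADDENDUM B.3, the «⟸» half of «K₄ ⟺ #Ш(E/ℚ)[2^∞] = 4^(M₀)», in kernel form).  gk2-p5's halving descent B2Q♭
(`PlusDescent.kFourPos_shape_of_mem_sha_rat_of_two_pow_pred_smul_ne_zero`, p771276) turns ONE class `a ∈ Ш(E/ℚ)` of `2`-power order with
`2^(M₀−1)·a ≠ 0` into the K4Pos-shape witness (a transposition-deep Kolyvagin prime `ℓ` and a datum of conductor `ℓ` with `P(ℓ) ∉ 2E(K[ℓ])`).
Such a class EXISTS as soon as `#Ш(E/ℚ)[2^∞] = 4^(M₀)` with `M₀ ≥ 1` and `#Sel₂(E/ℚ) ∣ 4`: otherwise `2^(M₀−1)` kills `Ш(E/ℚ)[2^∞]` and the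
filtration count (`OneBit.natCard_shaPrimary_rat_le_pow`: `#Y ≤ #Y[2]^(M₀−1) ≤ 4^(M₀−1)`, with `#Ш(E/ℚ)[2] ≤ #Sel₂(E/ℚ) ≤ 4` from
`PlusDescent.natCard_sha_torsionBy_le_natCard_selmerGroup`) contradicts `#Y = 4^(M₀)`.
* `exists_mem_sha_two_pow_pred_smul_ne_zero_of_natCard_shaPrimary_eq_pow` — the counting step (any `E/ℚ`, unconditional).
* ★ `kFourPos_shape_of_natCard_shaPrimary_rat_eq_pow` — on the B2Q♭ frame (habitat curve with an odd multiplicative prime, `K` with the two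
  Theorem-B₂ non-squares, `w(E) = +1`, the datum with `2^(M₀+1) ∤ P(1)`): **`#Ш(E/ℚ)[2^∞] = 4^(M₀)` ∧ `M₀ ≥ 1` ∧ `#Sel₂(E) ∣ 4` ⟹ the conclusion of
  K4Pos / K4Neg** (one prime `n = ℓ`), mod Q2.  So the Kolyvagin-free currency «`#Ш(E/ℚ)[2^∞] = 4^(M₀)`» (= what BSD predicts for the rank-0
  curve `E/ℚ` given the Gross–Zagier–Kolyvagin index `M₀`, LEAD ADDENDUM B.3) IMPLIES the kernel items' conclusion on the cut; the converse
  («K₄ ⟹ `#Ш(E_K)[2^∞] = 4^(M₀)`», Q3R_T′ / Q4_T″, proved) lands in `ℚ` by this seat's `hRC`-free consistency law (`…ShaConsistencyLawFree{,Cells}`).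

References: [McCallumLMS1991] §5 Prop. 5.3, Thm. 5.4; [Kolyvagin1989Izv] Thm. B₂; [GrossLMS1991] §5; [Fuchs1970] §8 Thm. 8.4; [SilvermanAEC2009] X.4.2.
-/

set_option autoImplicit false
set_option linter.dupNamespace false -- `Summit.<P>.<Sub>` repeats `BirchSwinnertonDyer` (D-0017)

noncomputable section

open scoped Classical

namespace Summit.BirchSwinnertonDyer.BirchSwinnertonDyer.Theorems.GenusExact.ShaCores

open WeierstrassCurve NumberField IsDedekindDomain Field AddSubgroup Literature.NumberTheory.EllipticCurves
  Literature.NumberTheory.GaloisRepresentations Literature.NumberTheory.EllipticCurves.ModularForms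
  Literature.NumberTheory.EllipticCurves.RingClassField
open Summit.BirchSwinnertonDyer.BirchSwinnertonDyer.Theses.GenusKolyvaginAtTwo (KolyvaginRelationAtTwo)
open Summit.BirchSwinnertonDyer.BirchSwinnertonDyer.Theorems.GenusExact.PlusDescent

variable (W : WeierstrassCurve ℚ) [W.IsElliptic]

/-! ## §1 Counting: `#Ш(E/ℚ)[2^∞] = 4^(M₀)` with `#Sel₂(E/ℚ) ∣ 4` forces a class not killed by `2^(M₀−1)` -/

/-- **A class of `Ш(E/ℚ)` not killed by `2^(M₀−1)`** exists whenever `Ш(E/ℚ)[2^∞]` is finite of order `4^(M₀)`, `M₀ ≥ 1`, and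
`#Sel₂(E/ℚ) ∣ 4`: otherwise `2^(M₀−1) · Ш(E/ℚ)[2^∞] = 0` and `#Ш(E/ℚ)[2^∞] ≤ #Ш(E/ℚ)[2]^(M₀−1) ≤ 4^(M₀−1)` (`#Ш(E/ℚ)[2] ≤ #Sel₂(E/ℚ)`).
Any `E/ℚ`; unconditional. [cite: Fuchs1970, §8 Thm. 8.4] [cite: SilvermanAEC2009, Thm. X.4.2 (a), (b)] -/
theorem exists_mem_sha_two_pow_pred_smul_ne_zero_of_natCard_shaPrimary_eq_pow [Finite (AddCommGroup.primaryComponent (↥W.sha) 2)]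
    {M₀ : ℕ} (hM₀ : 1 ≤ M₀) (hSel4 : Nat.card (W.selmerGroup 2) ∣ 4)
    (hY : Nat.card (AddCommGroup.primaryComponent (↥W.sha) 2) = 4 ^ M₀) :
    ∃ (k : ℕ) (a : W.galH1), a ∈ W.sha ∧ ((2 ^ k : ℕ) : ℤ) • a = 0 ∧ ((2 ^ (M₀ - 1) : ℕ) : ℤ) • a ≠ 0 := by
  haveI : Fact (Nat.Prime 2) := ⟨Nat.prime_two⟩
  -- `#Ш(E/ℚ)[2] ≤ #Sel₂(E/ℚ) ≤ 4`
  have h4 : Nat.card (AddSubgroup.torsionBy (↥W.sha) ((2 : ℕ) : ℤ)) ≤ 4 := by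
    have h1 := natCard_sha_torsionBy_le_natCard_selmerGroup W 2
    have hSel4' : Nat.card (selmerGroup W ((2 : ℕ) : ℤ)) ∣ 4 := by rw [Nat.cast_ofNat]; exact hSel4
    exact h1.trans (Nat.le_of_dvd (by norm_num) hSel4')
  by_contra hno
  push Not at hno
  -- then `2^(M₀−1)` kills `Ш(E/ℚ)[2^∞]`
  have hexp : ∀ a ∈ AddCommGroup.primaryComponent (↥W.sha) 2, 2 ^ (M₀ - 1) • a = 0 := by
    intro a ha
    obtain ⟨k, hk⟩ := (AddCommGroup.mem_primaryComponent).mp ha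
    have hka : ((2 ^ k : ℕ) : ℤ) • (a : W.galH1) = 0 := by
      rw [natCast_zsmul, ← AddSubgroupClass.coe_nsmul, hk, ZeroMemClass.coe_zero]
    have h := hno k (a : W.galH1) a.2 hka
    apply Subtype.ext
    rw [AddSubgroupClass.coe_nsmul, ZeroMemClass.coe_zero, ← natCast_zsmul]
    exact h
  have hle := OneBit.natCard_shaPrimary_rat_le_pow W hexp h4
  rw [hY] at hle
  have := (Nat.pow_le_pow_iff_right (by norm_num : 1 < 4)).mp hle
  omega

/-! ## §2 ★ `#Ш(E/ℚ)[2^∞] = 4^(M₀)` ⟹ the conclusion of K4Pos / K4Neg (mod Q2), on the B2Q♭ frame -/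

/-- ★ **THE K₄ WITNESS FROM THE BSD CARDINALITY OVER `ℚ`.**  On gk2-p5's B2Q♭ frame (globally minimal non-CM `E/ℚ`, odd Tamagawa product, an odd
multiplicative prime `v`, `ρ_{E,2^n}` onto for all `n`; `K` imaginary quadratic with `d_K` odd `≠ −3`, Heegner, the two Theorem-B₂ non-squares;
`w(E) = +1`; a conductor-`1` datum with `2^(M₀+1) ∤ P(1)`), modulo Q2: **if `Ш(E/ℚ)[2^∞]` is finite of order `4^(M₀)` with `M₀ ≥ 1` and
`#Sel₂(E/ℚ) ∣ 4`, then the conclusion of K4Pos / K4Neg holds** — a square-free `n` (one prime), a datum `d` of conductor `n`, every `ℓ ∣ n` a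
Zhang–Kolyvagin prime at `2` of index `≥ 2` with an arithmetic Frobenius moving a point of `E[2]`, and `P(n) ∉ 2E(K[n])`.  §1 + B2Q♭
(`PlusDescent.kFourPos_shape_of_mem_sha_rat_of_two_pow_pred_smul_ne_zero`).  CONDITIONAL on Q2; BSD / K4Pos / K4Neg are NOT proved by this.
[cite: McCallumLMS1991, §5 Prop. 5.3, Thm. 5.4] [cite: Kolyvagin1989Izv, Thm. B₂] [cite: GrossLMS1991, §5 Prop. 5.3] -/
theorem kFourPos_shape_of_natCard_shaPrimary_rat_eq_pow (hQ2 : KolyvaginRelationAtTwo)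
    [W.IsGloballyMinimal] [NeZero (W.conductorNorm ℤ)] (hcm : ¬ W.HasCM)
    (hT : Odd W.tamagawaProduct) (v : HeightOneSpectrum (𝓞 ℚ)) (h2v : ((2 : ℕ) : 𝓞 ℚ) ∉ v.asIdeal)
    (hNv : ((W.conductorNorm ℤ : ℕ) : 𝓞 ℚ) ∈ v.asIdeal) (hmult : W.HasMultiplicativeReductionAt v)
    (K : Type) [Field K] [NumberField K] (hIQ : IsImaginaryQuadratic K) (hodd : Odd (NumberField.discr K))
    (h3 : NumberField.discr K ≠ -3) (hHe : SatisfiesHeegnerHypothesis (W.conductorNorm ℤ) K)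
    (hsq1 : ¬ IsSquare ((NumberField.discr K : ℚ) * -|W.Δ|)) (hsq2 : ¬ IsSquare ((NumberField.discr K : ℚ) * (-(2 * |W.Δ|))))
    (hρ : ∀ n : ℕ, 0 < n → W.HasSurjectiveModNGaloisRep ((2 : ℤ) ^ n))
    (Dt : ModularParametrizationData W (W.conductorNorm ℤ)) (β : ℤ) (ι : K →+* ℂ) (d₁ : KolyvaginHeegnerData Dt β ι 1) (M₀ : ℕ)
    (hndiv : ¬ ∃ Q : (W.baseChange (ringClassField K ι 1)).toAffine.Point, ((2 ^ (M₀ + 1) : ℕ) : ℤ) • Q = d₁.derivedPoint)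
    (hw1 : W.rootNumber = 1) (hM₀ : 1 ≤ M₀) (hSel4 : Nat.card (W.selmerGroup 2) ∣ 4)
    [Finite (AddCommGroup.primaryComponent (↥W.sha) 2)] (hY : Nat.card (AddCommGroup.primaryComponent (↥W.sha) 2) = 4 ^ M₀) :
    ∃ (n : ℕ) (d : KolyvaginHeegnerData Dt β ι n), Squarefree n ∧
      (∀ ℓ ∈ n.primeFactors, Zhang2014.IsKolyvaginPrime (W.conductorNorm ℤ) W K 2 ℓ ∧ 2 ≤ Zhang2014.kolyvaginIndex W 2 ℓ ∧
        ∃ (v : HeightOneSpectrum (𝓞 ℚ)) (𝔓 : Ideal (absIntegers (𝓞 ℚ) ℚ)) (h : absoluteGaloisGroup ℚ),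
          ((ℓ : ℕ) : 𝓞 ℚ) ∈ v.asIdeal ∧ 𝔓 ∈ v.primesAbove ∧ IsArithFrobAt (𝓞 ℚ) h 𝔓 ∧ ∃ u : W.geomTorsion ((2 : ℕ) : ℤ), h • u ≠ u) ∧
      ¬ ∃ Q : (W.baseChange (ringClassField K ι n)).toAffine.Point, (2 : ℤ) • Q = d.derivedPoint := by
  obtain ⟨k, a, ha, hka, hne⟩ := exists_mem_sha_two_pow_pred_smul_ne_zero_of_natCard_shaPrimary_eq_pow W hM₀ hSel4 hY
  exact kFourPos_shape_of_mem_sha_rat_of_two_pow_pred_smul_ne_zero hQ2 W hcm hT v h2v hNv hmult K hIQ hodd h3 hHe hsq1 hsq2 hρ Dt β ι d₁ M₀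
    hndiv hw1 k a ha hka hne

end Summit.BirchSwinnertonDyer.BirchSwinnertonDyer.Theorems.GenusExact.ShaCores

end
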